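import Summits.BirchSwinnertonDyer.Rank1Residual.Additive.TameBranchOfTwistBranch
import Summits.BirchSwinnertonDyer.Rank1Residual.Additive.LegendreTwistMinusRelationOfCurveTwist
import Summits.BirchSwinnertonDyer.Rank1Residual.Additive.ChiBranchConstantTermOdd
import Literature.NumberTheory.EllipticCurves.PAdicLFunctionMinusBranchInterpolationProofs
import HarnessLib

/-!
# Class N10 / X3♯(G-ord), X4♯(G-ord), defect 2, ODD branch (`p ≡ 3 (mod 4)`): the power-series
# dictionary — the E-normalised tame branch of `E = E♭ ⊗ χ_{−p}` IS `c · L⁻_p(f_{E♭}, α, ω^{(p−1)/2}, T)`,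
# the MINUS Mazur–Tate–Teitelbaum branch of its good ordinary twist (sub-cell additive-p2, gen 22)

HONEST FRAMING (cell `b2b-bsdres`, run/shared/lean/b2b/bsd-rank1-residual/, verbatim in every
file): the goal of the cell is to DELETE the COMBINATION-SHAPED residual classes of the
Birch–Swinnerton-Dyer formula for ALL analytic-rank `≤ 1` elliptic curves over `ℚ` — "full BSD
formula for every rank `≤ 1` curve in class `C`" assembled STRICTLY from published theorems — so
that the rank-`≤ 1` remainder becomes exactly the CONSTRUCTION-SHAPED classes, which are TYPED
(missing-input `Prop`s), NOT attempted. This is not "finishing BSD". Sub-cell `additive-p2`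
(X3♯(G-ord) / X4♯(G-ord)), generation 22: research route; labels / census / located gap UNCHANGED;
nothing is booked. THEOREMS ONLY: no definition, no named fact, no conjecture node.

## What

The odd twin of `TameBranchOfTwistBranch.lean`. At `p ≡ 3 (mod 4)` the quadratic subfield of
`ℚ(μ_p)` is `ℚ(√−p)`, the character `χ_p = ω^{(p−1)/2}` is ODD, the twist `E♭ ↦ E = E♭ ⊗ χ_{−p}`
swaps real and imaginary periods, and the relevant branch of `E♭`'s `p`-adic `L`-function lives on the
MINUS modular symbols: `L⁻_p(g, α, ω^{(p−1)/2}, T) = padicLFunctionMinusBranch g α (p/2)`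
(`PAdicLFunctionMinus`; the object of the `else` branch of the Kato / Wuthrich component bricks).
cc-typer-2 GEN 4 typed and PROVED the comparison statement on this branch
(`LegendreTwistMinusRel p f g c`: `[s]⁺_{f_E} = c·∑_u(u/p)[s+u/p]⁻_g`,
`exists_legendreTwistMinusRel_of_twist`) and produced the tame branch existentially
(`exists_isTameBranchOf_of_goodOrd_twist_neg`). With the minus-branch interpolation
(`Literature/…/PAdicLFunctionMinusBranchInterpolationProofs.lean`, this seat gen 22) THIS FILE names it:

* `isTameBranchOf_legendre_C_mul_padicLFunctionMinusBranch`: for `V` (`E♭`) globally minimal,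
  ordinary at the odd prime `p`, newform `g`, `α = unitRoot V p`, and `f` with `LegendreTwistMinusRel p f g c`:
  **`IsTameBranchOf f p (ι∘χ_p) α (C(c) · L⁻_p(g, α, ω^{(p−1)/2}, T))`** — boundedness
  (`norm_coeff_padicLFunctionMinusBranch_le` with `exists_norm_msdMinusMeasure_le_of_maninDrinfeld`),
  constant term (`constantCoeff_padicLFunctionMinusBranch_half` = `α⁻¹∑_a(a/p)[a/p]⁻_g`, and the
  relation at `s = 0`), interpolation rows (`hasSum_padicLMinusBranchCoeff_mul_pow_of_isPrimitive` +
  `teichWeight_half_castHom_eq_legendreChar` + cc-typer-2's `sum_mul_twistPartnerMeasure_eq` run with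
  `Φ = c·[·]⁻_g`);
* uniqueness / `↔` / dichotomy forms (`IsTameBranchOf.eq_C_mul_padicLFunctionMinusBranch`, …) and the
  curve-level form at `p ≡ 3 (mod 4)` (`exists_forall_isTameBranchOf_iff_of_goodOrd_twist_neg`).

What is NOT claimed: the (M) rows; any Literature fact; any booking. Labels UNCHANGED.

References: Mazur–Tate–Teitelbaum, Invent. Math. 84 (1986) §I.8, §I.10 (10.1), §I.13–I.14 (14.3)
[MazurTateTeitelbaum1986Invent]; Delbourgo, Compositio Math. 113 (1998) §1.5–1.6 [Delbourgo1998];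
cc-typer-2's `TameBranchOfSemistableTwistJoin.lean`, `LegendreTwistMinusRelationOfCurveTwist.lean`.
-/

noncomputable section

open scoped Classical MatrixGroups ModularForm

open CongruenceSubgroup

namespace Summit.BirchSwinnertonDyer.Rank1Residual.Additive

open Literature.NumberTheory.EllipticCurves Literature.NumberTheory.EllipticCurves.ModularForms
  Literature.NumberTheory.EllipticCurves.Rank1Residual WeierstrassCurve

section Dictionary

variable {p : ℕ} [hp : Fact p.Prime] {N N' : ℕ} [NeZero N'] {f : CuspForm (Gamma0 N) 2}
  {g : CuspForm (Gamma0 N') 2} (V : WeierstrassCurve ℚ) [V.IsElliptic] [V.IsGloballyMinimal]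

/-- **THE DICTIONARY, odd branch.** Let `V` (`E♭`) be globally minimal and ORDINARY at the odd prime
`p`, `g` its newform, `α = unitRoot V p`, and let the weight-2 cusp form `f` satisfy the odd Legendre
twist relation `LegendreTwistMinusRel p f g c` (`[s]⁺_f = c·∑_{u mod p}(u/p)[s+u/p]⁻_g`; for
`f = f_E`, `E ≅ V ⊗ χ_{−p}`, `p ≡ 3 (mod 4)` a THEOREM, `exists_legendreTwistMinusRel_of_twist`). Then
`C(c)·L⁻_p(g, α, ω^{(p−1)/2}, T)` (`padicLFunctionMinusBranch g α (p/2)`) satisfies cc-typer-2's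
package `IsTameBranchOf f p (ι∘χ_p) α`: bounded (`norm_coeff_padicLFunctionMinusBranch_le`, the bound
of `μ⁻` from Manin–Drinfeld), constant term `c·α⁻¹∑_a(a/p)[a/p]⁻_g = α⁻¹[0]⁺_f`
(`constantCoeff_padicLFunctionMinusBranch_half`), and at a primitive wild `κ` of conductor `p^m ≥ p²`
the value `c·α^{−m}∑_a κ(a)(a/p)[a/p^m]⁻_g = α^{−m}p^{−1}τ(χ_p,ψ_κ)∑_b κ(b)[b/p^m]⁺_f`
(`hasSum_padicLMinusBranchCoeff_mul_pow_of_isPrimitive`, `teichWeight_half_castHom_eq_legendreChar`,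
`sum_mul_twistPartnerMeasure_eq` with `Φ = c·[·]⁻_g`).
[cite: MazurTateTeitelbaum1986Invent, §I.13–I.14 (14.3)] [cite: Delbourgo1998, §1.5–1.6] -/
theorem isTameBranchOf_legendre_C_mul_padicLFunctionMinusBranch (hp2 : p ≠ 2)
    (hord : IsOrdinaryAt V p) (hg : IsNewformOf V g) {c : ℚ} (hrel : LegendreTwistMinusRel p f g c) :
    IsTameBranchOf f p ((legendreChar p).ringHomComp (algebraMap ℚ_[p] ℂ_[p]))
      (unitRoot V p : ℚ_[p])
      (PowerSeries.C (c : ℚ_[p]) * padicLFunctionMinusBranch g (unitRoot V p : ℚ_[p]) (p / 2)) := by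
  haveI : NeZero p := ⟨hp.out.ne_zero⟩
  set α : ℚ_[p] := (unitRoot V p : ℚ_[p]) with hα
  set ι : ℚ_[p] →+* ℂ_[p] := algebraMap ℚ_[p] ℂ_[p] with hι
  have hdist := msdMinusMeasure_distribution_of_isNewformOf p V hord hg
  obtain ⟨C, hC⟩ := exists_norm_msdMinusMeasure_le_of_maninDrinfeld (p := p)
    (exists_nsmul_modularSymbol_mem_periodLattice_of_isNewformOf hg) (unitRoot_coe_spec hord).2.1
  -- the unstabilised partner symbol `Φ = c·[·]⁻_g`
  set Φ : ℚ → ℚ_[p] := fun r ↦ (c : ℚ_[p]) * ((ratMinusSymbol g r : ℚ) : ℚ_[p]) with hΦ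
  have hper : ∀ s, Φ (s + 1) = Φ s := fun s ↦ by
    simp only [hΦ]
    rw [show (s + 1 : ℚ) = s + ((1 : ℤ) : ℚ) by push_cast; rfl, ratMinusSymbol_add_intCast]
  have hx : ∀ s, ((ratPlusSymbol f s : ℚ) : ℚ_[p]) =
      ∑ b : ZMod p, (legendreChar p)⁻¹ b * Φ (s + (b.val : ℚ) / p) := fun s ↦ hrel.cast_eq_twist s
  refine ⟨⟨‖(c : ℚ_[p])‖ * C, fun n ↦ ?_⟩, ?_, ?_⟩
  · -- bounded
    rw [PowerSeries.coeff_C_mul, norm_mul]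
    exact mul_le_mul_of_nonneg_left (norm_coeff_padicLFunctionMinusBranch_le g α hdist hC _ n)
      (norm_nonneg _)
  · -- constant term
    rw [map_mul, PowerSeries.constantCoeff_C,
      constantCoeff_padicLFunctionMinusBranch_half p hp2 V hord hg]
    have h0 : ratPlusSymbol f 0 = c * legendreMinusSymbolSum g p := by
      rw [hrel 0, legendreMinusSymbolSum_def]
      simp_rw [zero_add]
    rw [h0]
    push_cast
    ring
  · -- interpolation at primitive wild `κ` of conductor `p^m`, `m ≥ 2`
    intro m hm κ hκ heven hordκ
    obtain ⟨m', rfl⟩ : ∃ m', m = m' + 1 := ⟨m - 1, by omega⟩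
    have he : cyclotomicExponent p ≤ m' := by rw [cyclotomicExponent_eq_one p hp2]; omega
    have h1 := hasSum_padicLMinusBranchCoeff_mul_pow_of_isPrimitive g α hdist hC (p / 2) he κ hκ heven
      hordκ
    have h2 := h1.mul_left (ι (c : ℚ_[p]))
    have hval := sum_mul_twistPartnerMeasure_eq (f := f) (ã := α) hm (legendreChar_ne_one p hp2) hper
      hx hκ
    have hv : ∑ a : ZMod (p ^ (m' + 1)), κ a * ι (twistPartnerMeasure (legendreChar p) Φ α
          ((ratPlusSymbol f 0 : ℚ) : ℚ_[p]) (m' + 1) a) =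
        ι (c : ℚ_[p]) * (ι (α⁻¹ ^ (m' + 1)) * ∑ a : ZMod (p ^ (m' + 1)), κ a *
          ι (teichWeight p (p / 2) (ZMod.castHom (pow_dvd_pow p (he.trans m'.le_succ))
            (ZMod (p ^ cyclotomicExponent p)) a)) *
          (ratMinusSymbol g ((a.val : ℚ) / ((p ^ (m' + 1) : ℕ) : ℚ)) : ℂ_[p])) := by
      rw [Finset.mul_sum, Finset.mul_sum]
      refine Finset.sum_congr rfl fun a _ ↦ ?_
      rw [twistPartnerMeasure_succ,
        teichWeight_half_castHom_eq_legendreChar p hp2 (he.trans m'.le_succ) a, legendreChar_inv]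
      simp only [hΦ, map_mul, map_ratCast, Nat.cast_pow]
      ring
    have hfun : (fun k : ℕ ↦ ι (PowerSeries.coeff k (PowerSeries.C (c : ℚ_[p]) *
          padicLFunctionMinusBranch g α (p / 2))) *
            (κ (cyclotomicGenerator p : ZMod (p ^ (m' + 1))) - 1) ^ k) =
        fun k : ℕ ↦ ι (c : ℚ_[p]) * (ι (padicLMinusBranchCoeff g α (p / 2) k) *
          (κ (cyclotomicGenerator p : ZMod (p ^ (m' + 1))) - 1) ^ k) := by
      funext k
      rw [PowerSeries.coeff_C_mul, coeff_padicLFunctionMinusBranch, map_mul, mul_assoc]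
    rw [hfun, ← hval, hv]
    exact h2

/-! ### Uniqueness: EVERY E-normalised tame branch on these rows is that series -/

/-- **Every E-normalised tame branch for `(f, χ_p, unitRoot V p)` IS `C(c)·L⁻_p(g, α, ω^{(p−1)/2}, T)`**
under the odd Legendre twist relation (the dictionary + `IsTameBranchOf.unique`).
[cite: MazurTateTeitelbaum1986Invent, §I.11 and §I.14 (14.3)] -/
theorem IsTameBranchOf.eq_C_mul_padicLFunctionMinusBranch (hp2 : p ≠ 2) (hord : IsOrdinaryAt V p)
    (hg : IsNewformOf V g) {c : ℚ} (hrel : LegendreTwistMinusRel p f g c) {B : PowerSeries ℚ_[p]}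
    (hB : IsTameBranchOf f p ((legendreChar p).ringHomComp (algebraMap ℚ_[p] ℂ_[p]))
      (unitRoot V p : ℚ_[p]) B) :
    B = PowerSeries.C (c : ℚ_[p]) * padicLFunctionMinusBranch g (unitRoot V p : ℚ_[p]) (p / 2) :=
  hB.unique (isTameBranchOf_legendre_C_mul_padicLFunctionMinusBranch V hp2 hord hg hrel)

/-- `↔` form of the odd dictionary. [folklore] -/
theorem isTameBranchOf_legendre_iff_eq_C_mul_padicLFunctionMinusBranch (hp2 : p ≠ 2)
    (hord : IsOrdinaryAt V p) (hg : IsNewformOf V g) {c : ℚ} (hrel : LegendreTwistMinusRel p f g c)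
    (B : PowerSeries ℚ_[p]) :
    IsTameBranchOf f p ((legendreChar p).ringHomComp (algebraMap ℚ_[p] ℂ_[p]))
        (unitRoot V p : ℚ_[p]) B ↔
      B = PowerSeries.C (c : ℚ_[p]) * padicLFunctionMinusBranch g (unitRoot V p : ℚ_[p]) (p / 2) :=
  ⟨fun hB ↦ hB.eq_C_mul_padicLFunctionMinusBranch V hp2 hord hg hrel,
    fun h ↦ h ▸ isTameBranchOf_legendre_C_mul_padicLFunctionMinusBranch V hp2 hord hg hrel⟩

/-- **Curve level, `p ≡ 3 (mod 4)`, UNCONDITIONAL.** For `E = W ≅ V ⊗ χ_{−p}` additive at `p`, `V`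
globally minimal GOOD ORDINARY at `p`, `f`, `g` the newforms of `W`, `V`: there is `c ∈ ℚ` such that the
E-normalised tame branches of `(f, χ_p, unitRoot V p)` are EXACTLY the one series
`C(c)·L⁻_p(g, unitRoot V p, ω^{(p−1)/2}, T)` (comparison hypothesis discharged by cc-typer-2's
`exists_legendreTwistMinusRel_of_twist`). [cite: MazurTateTeitelbaum1986Invent, §I.13–I.14 (14.3)]
[cite: Shimura1971, Prop. 3.64] -/
theorem exists_forall_isTameBranchOf_iff_of_goodOrd_twist_neg (hp4 : p % 4 = 3)
    (W : WeierstrassCurve ℚ) [W.IsElliptic] [NeZero N]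
    (hVW : ∃ C : VariableChange ℚ, C • V.quadraticTwist (-(p : ℚ)) = W) (hadd : Addv W p)
    (hord : GoodOrd V p) (hf : IsNewformOf W f) (hg : IsNewformOf V g) :
    ∃ c : ℚ, ∀ B : PowerSeries ℚ_[p],
      IsTameBranchOf f p ((legendreChar p).ringHomComp (algebraMap ℚ_[p] ℂ_[p]))
          (unitRoot V p : ℚ_[p]) B ↔
        B = PowerSeries.C (c : ℚ_[p]) * padicLFunctionMinusBranch g (unitRoot V p : ℚ_[p]) (p / 2) := by
  have hp2 : p ≠ 2 := (ne_two_and_legendreSym_neg_one_of_mod_four_eq_three (p := p) hp4).1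
  obtain ⟨c, hrel⟩ := exists_legendreTwistMinusRel_of_twist hp4 V W hVW hadd hf hg
  exact ⟨c, fun B ↦ isTameBranchOf_legendre_iff_eq_C_mul_padicLFunctionMinusBranch V hp2
    ((isOrdinaryAt_iff V p).mpr hord) hg hrel B⟩

/-- **Dichotomy for EVERY tuple of the package** (gen 21's `IsTameBranchOf.eq_zero_or_tuple_eq`): under
the odd Legendre twist relation with `c·L⁻_p(g, α, ω^{(p−1)/2}, T) ≠ 0`, every tuple `(ε', α', B')`
with `IsTameBranchOf f p ε' α' B'` is degenerate (`α' = 0 ∧ B' = 0`) or equal to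
`(ι∘χ_p, unitRoot V p, C(c)·L⁻_p(g, α, ω^{(p−1)/2}, T))`. [folklore] -/
theorem IsTameBranchOf.eq_zero_or_eq_C_mul_padicLFunctionMinusBranch (hp2 : p ≠ 2)
    (hord : IsOrdinaryAt V p) (hg : IsNewformOf V g) {c : ℚ} (hrel : LegendreTwistMinusRel p f g c)
    (hne : PowerSeries.C (c : ℚ_[p]) * padicLFunctionMinusBranch g (unitRoot V p : ℚ_[p]) (p / 2) ≠ 0)
    {ε' : DirichletCharacter ℂ_[p] p} {α' : ℚ_[p]} {B' : PowerSeries ℚ_[p]}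
    (h' : IsTameBranchOf f p ε' α' B') :
    (α' = 0 ∧ B' = 0) ∨
      (ε' = (legendreChar p).ringHomComp (algebraMap ℚ_[p] ℂ_[p]) ∧ α' = (unitRoot V p : ℚ_[p]) ∧
        B' = PowerSeries.C (c : ℚ_[p]) * padicLFunctionMinusBranch g (unitRoot V p : ℚ_[p]) (p / 2)) :=
  IsTameBranchOf.eq_zero_or_tuple_eq hp2
    (isTameBranchOf_legendre_C_mul_padicLFunctionMinusBranch V hp2 hord hg hrel) h' hne

end Dictionary

end Summit.BirchSwinnertonDyer.Rank1Residual.Additive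

end
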